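import Summits.SmoothPoincare4.SmoothPoincare4.Theorems.ConvexBisectionAcyclicBisectionExistsBeltTubeCurvesFraming
import Summits.SmoothPoincare4.SmoothPoincare4.Theorems.ConvexBisectionAcyclicBisectionExistsBeltSlideToTube
import Summits.SmoothPoincare4.SmoothPoincare4.Theorems.ConvexBisectionAcyclicBisectionExistsBeltIsotopyPush
import Summits.SmoothPoincare4.SmoothPoincare4.Theorems.ConvexBisectionAcyclicBisectionExistsPageTube
import HarnessLib

/-!
# The push-off isotopy of the belt circle inside a page tube, I: start data and the fibre path
(node T3c-1 `node_belt_isotopic_pushoff` of the sub-goal T3 of stub `stub_steinRealisation` (NF6), line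
`modp-braid-orbits`, crux `ConvexBisection.AcyclicBisectionExists`, item stmt-SmoothPoincare4-10508;
wave 4, worker Y2, lead c5; stage (3d))

Stage (3c) (`helper_belt_slideToAnyTube`, worker Z5) leaves the belt circle of a Lefschetz `2`-handle as
the explicit framed curve `θ ↦ Φ₂ (uDir b θ, reflFibre s (r θ))`, framing
`d/dε|₀ Φ₂ (uDir b θ, reflFibre s (r θ) + ε reflFibre s (θ²))` (`tubeEndPoint`, `tubeEndFraming`), in a
tube `Φ₂` of the boundary.  For stage (3d) the tube is the TWISTED page tube `Φ₂ = twistTube Φ σ`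
(`σ² = 1`, worker Z4): `Φ₂ (ψ, v) = Φ (ψ, fibreRot σ ψ v)`.  Here:

* §1 sign algebra: under the winding condition **`σ · slideSign b = −s`** (the start longitude and the
  page push-off have the same fibre winding) the start data read, in the UNtwisted coordinates of `Φ`,
  `fibreRot σ (uDir b θ) (reflFibre s (r θ)) = r e₀` (a constant fibre vector) and
  `fibreRot σ (uDir b θ) (reflFibre s (θ²)) = reflFibre s θ = (θ₀, s θ₁)`;
* §2 the fibre path `t ↦ (r cos (πt/2), −η sin (πt/2))` of the push-off isotopy — from `r e₀` to the
  push-off depth `−η e₁` through non-zero fibre vectors of norm `< 1`;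
* §3 the start point / start framing of Z5 in `Φ`-coordinates (`tubeEndPoint_twistTube`,
  `tubeEndFraming_twistTube`) and **the push-off isotopy** `exists_pushoffIsotopy`: a
  `KnotIsotopyInBoundary` from Z5's end curve to `θ ↦ Φ (uDir b θ, −η e₁)` with all stages
  `Φ (uDir b θ, w_t)`, `w_t ≠ 0`, carrying Z5's end framing to the fibre framings
  `d/dε|₀ Φ (uDir b θ, w_t + ε reflFibre s θ)` (`tubeCurveIsotopy`, `isFramingAlong_tubeCurve` of Z5);
* §4 registered helper `helper_belt_pushoffStart`.

Everything is proved; no named facts.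

## References
* A. A. Kosinski, *Differential Manifolds*, Academic Press (1993), III §3, VI §6. [Kosinski1993]
* R. E. Gompf, A. I. Stipsicz, *4-Manifolds and Kirby Calculus* (1999), §4.5, §8.2. [GompfStipsicz1999]
-/

noncomputable section

-- the prescribed namespace `Summit.<P>.<Sub>.…` duplicates `SmoothPoincare4` (P = Sub)
set_option linter.dupNamespace false

open scoped Manifold ContDiff Topology Real
open Set Function Metric

namespace Summit.SmoothPoincare4.SmoothPoincare4.Theorems.AcyclicBisectionExists.ModpBraidOrbits

open Literature.Topology.FourManifolds Literature.Geometry.Symplectic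

/-! ### §1 Sign algebra: Z5's start data in the untwisted coordinates -/

/-- On the unit circle `θ₀² + θ₁² = 1`: this is
`Literature.Topology.FourManifolds.sphere_coord_sq_add_sq` (deprecated duplicate kept as an alias,
dedup-03048). [folklore] -/
@[deprecated Literature.Topology.FourManifolds.sphere_coord_sq_add_sq (since := "2026-08-17")]
alias coe_sphere_sq_add_sq := Literature.Topology.FourManifolds.sphere_coord_sq_add_sq

/-- **The start fibre is the constant vector `r e₀`** in the untwisted coordinates, under the winding
condition `σ · slideSign b = −s`. [folklore] -/
theorem fibreRot_uDir_reflFibre_smul {σ s : ℝ} {b : Bool} (hs : s ^ 2 = 1) (hsg : σ * slideSign b = -s)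
    (r : ℝ) (θ : sphere (0 : EuclideanSpace ℝ (Fin 2)) 1) :
    fibreRot σ ((uDir b θ : sphere (0 : EuclideanSpace ℝ (Fin 2)) 1) : EuclideanSpace ℝ (Fin 2))
      (reflFibre s (r • (θ : EuclideanSpace ℝ (Fin 2)))) = r • planeE0 := by
  have hθ := sphere_coord_sq_add_sq θ
  ext i
  fin_cases i
  · simp [reflFibre, fibreRot_apply_zero]
    linear_combination r * hθ + (-(s * r * (θ : EuclideanSpace ℝ (Fin 2)) 1 ^ 2)) * hsg +
      (r * (θ : EuclideanSpace ℝ (Fin 2)) 1 ^ 2) * hs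
  · simp [reflFibre, fibreRot_apply_one]
    linear_combination (r * (θ : EuclideanSpace ℝ (Fin 2)) 0 * (θ : EuclideanSpace ℝ (Fin 2)) 1) * hsg

/-- **The start framing direction is `reflFibre s θ = (θ₀, s θ₁)`** in the untwisted coordinates, under
the winding condition. [folklore] -/
theorem fibreRot_uDir_reflFibre_sqDir {σ s : ℝ} {b : Bool} (hs : s ^ 2 = 1) (hsg : σ * slideSign b = -s)
    (θ : sphere (0 : EuclideanSpace ℝ (Fin 2)) 1) :
    fibreRot σ ((uDir b θ : sphere (0 : EuclideanSpace ℝ (Fin 2)) 1) : EuclideanSpace ℝ (Fin 2))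
      (reflFibre s (sqDir θ)) = reflFibre s (θ : EuclideanSpace ℝ (Fin 2)) := by
  have hθ := sphere_coord_sq_add_sq θ
  ext i
  fin_cases i
  · simp [reflFibre, sqDir, fibreRot_apply_zero]
    linear_combination (θ : EuclideanSpace ℝ (Fin 2)) 0 * hθ +
      (-(2 * s * (θ : EuclideanSpace ℝ (Fin 2)) 0 * (θ : EuclideanSpace ℝ (Fin 2)) 1 ^ 2)) * hsg +
      (2 * (θ : EuclideanSpace ℝ (Fin 2)) 0 * (θ : EuclideanSpace ℝ (Fin 2)) 1 ^ 2) * hs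
  · simp [reflFibre, sqDir, fibreRot_apply_one]
    linear_combination (s * (θ : EuclideanSpace ℝ (Fin 2)) 1) * hθ +
      ((θ : EuclideanSpace ℝ (Fin 2)) 1 * ((θ : EuclideanSpace ℝ (Fin 2)) 0 ^ 2 -
        (θ : EuclideanSpace ℝ (Fin 2)) 1 ^ 2)) * hsg

/-! ### §2 The fibre path `t ↦ (r cos (πt/2), −η sin (πt/2))` of the push-off isotopy -/

/-- Coordinates of the fibre path. [folklore] -/
theorem pushoffFibre_apply (r η t : ℝ) :
    ((r * Real.cos (π / 2 * t)) • planeE0 + (-(η * Real.sin (π / 2 * t))) • planeE1 : EuclideanSpace ℝ (Fin 2)) 0 =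
        r * Real.cos (π / 2 * t) ∧
      ((r * Real.cos (π / 2 * t)) • planeE0 + (-(η * Real.sin (π / 2 * t))) • planeE1 : EuclideanSpace ℝ (Fin 2)) 1 =
        -(η * Real.sin (π / 2 * t)) := by
  constructor <;> simp

/-- The fibre path starts at `r e₀`. [folklore] -/
theorem pushoffFibre_zero (r η : ℝ) :
    ((r * Real.cos (π / 2 * (0 : ℝ))) • planeE0 + (-(η * Real.sin (π / 2 * (0 : ℝ)))) • planeE1 :
      EuclideanSpace ℝ (Fin 2)) = r • planeE0 := by
  simp

/-- The fibre path ends at the push-off depth `−η e₁`. [folklore] -/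
theorem pushoffFibre_one (r η : ℝ) :
    ((r * Real.cos (π / 2 * (1 : ℝ))) • planeE0 + (-(η * Real.sin (π / 2 * (1 : ℝ)))) • planeE1 :
      EuclideanSpace ℝ (Fin 2)) = (-η) • planeE1 := by
  simp

/-- **The fibre path stays in the unit disc** (`0 ≤ r, η < 1`). [folklore] -/
theorem norm_pushoffFibre_lt {r η : ℝ} (hr0 : 0 ≤ r) (hr1 : r < 1) (hη0 : 0 ≤ η) (hη1 : η < 1) (t : ℝ) :
    ‖((r * Real.cos (π / 2 * t)) • planeE0 + (-(η * Real.sin (π / 2 * t))) • planeE1 : EuclideanSpace ℝ (Fin 2))‖ < 1 := by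
  have hr2 : r ^ 2 < 1 := by nlinarith
  have hη2 : η ^ 2 < 1 := by nlinarith
  have hc := Real.cos_sq_add_sin_sq (π / 2 * t)
  have key : (r * Real.cos (π / 2 * t)) ^ 2 + (-(η * Real.sin (π / 2 * t))) ^ 2 =
      1 - ((1 - r ^ 2) * Real.cos (π / 2 * t) ^ 2 + (1 - η ^ 2) * Real.sin (π / 2 * t) ^ 2) := by
    linear_combination hc
  have pos : 0 < (1 - r ^ 2) * Real.cos (π / 2 * t) ^ 2 + (1 - η ^ 2) * Real.sin (π / 2 * t) ^ 2 := by
    nlinarith [mul_pos (sub_pos.2 hr2) (sub_pos.2 hη2),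
      mul_nonneg (mul_nonneg (sub_nonneg.2 hr2.le) (sq_nonneg (Real.cos (π / 2 * t)))) (sq_nonneg η),
      mul_nonneg (mul_nonneg (sub_nonneg.2 hη2.le) (sq_nonneg (Real.sin (π / 2 * t)))) (sq_nonneg r)]
  have hsq : ‖((r * Real.cos (π / 2 * t)) • planeE0 + (-(η * Real.sin (π / 2 * t))) • planeE1 :
      EuclideanSpace ℝ (Fin 2))‖ ^ 2 < 1 := by
    rw [EuclideanSpace.real_norm_sq_eq, Fin.sum_univ_two, (pushoffFibre_apply r η t).1, (pushoffFibre_apply r η t).2, key]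
    linarith
  nlinarith [norm_nonneg ((r * Real.cos (π / 2 * t)) • planeE0 + (-(η * Real.sin (π / 2 * t))) • planeE1 :
    EuclideanSpace ℝ (Fin 2))]

/-- **The fibre path avoids the origin** (`0 < r, η`): it never meets the core. [folklore] -/
theorem pushoffFibre_ne_zero {r η : ℝ} (hr : 0 < r) (hη : 0 < η) (t : ℝ) :
    ((r * Real.cos (π / 2 * t)) • planeE0 + (-(η * Real.sin (π / 2 * t))) • planeE1 : EuclideanSpace ℝ (Fin 2)) ≠ 0 := by
  intro h0
  have h₀ := congrArg (fun v : EuclideanSpace ℝ (Fin 2) => v 0) h0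
  have h₁ := congrArg (fun v : EuclideanSpace ℝ (Fin 2) => v 1) h0
  simp only [(pushoffFibre_apply r η t).1, (pushoffFibre_apply r η t).2, PiLp.zero_apply, neg_eq_zero,
    mul_eq_zero, hr.ne', hη.ne', false_or] at h₀ h₁
  have := Real.cos_sq_add_sin_sq (π / 2 * t)
  rw [h₀, h₁] at this
  norm_num at this

/-- The fibre path is jointly smooth (it does not depend on the circle variable). [folklore] -/
theorem contMDiff_pushoffFibre (r η : ℝ) :
    ContMDiff (𝓘(ℝ, ℝ).prod (𝓡 1)) 𝓘(ℝ, EuclideanSpace ℝ (Fin 2)) ∞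
      fun p : ℝ × (sphere (0 : EuclideanSpace ℝ (Fin 2)) 1) =>
        ((r * Real.cos (π / 2 * p.1)) • planeE0 + (-(η * Real.sin (π / 2 * p.1))) • planeE1 : EuclideanSpace ℝ (Fin 2)) := by
  have h : ContDiff ℝ ∞ fun t : ℝ =>
      ((r * Real.cos (π / 2 * t)) • planeE0 + (-(η * Real.sin (π / 2 * t))) • planeE1 : EuclideanSpace ℝ (Fin 2)) := by
    fun_prop
  exact h.contMDiff.comp contMDiff_fst

/-- `reflFibre s` is smooth. [folklore] -/
theorem contDiff_reflFibre (s : ℝ) : ContDiff ℝ ∞ (reflFibre s) := by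
  have h0 : ContDiff ℝ ∞ fun x : EuclideanSpace ℝ (Fin 2) => x 0 := contDiff_piLp_apply 2 (i := (0 : Fin 2))
  have h1 : ContDiff ℝ ∞ fun x : EuclideanSpace ℝ (Fin 2) => x 1 := contDiff_piLp_apply 2 (i := (1 : Fin 2))
  unfold reflFibre
  exact (h0.smul contDiff_const).add ((contDiff_const.mul h1).smul contDiff_const)

/-- The framing direction `(t, θ) ↦ reflFibre s θ` is jointly smooth. [folklore] -/
theorem contMDiff_reflFibre_snd (s : ℝ) :
    ContMDiff (𝓘(ℝ, ℝ).prod (𝓡 1)) 𝓘(ℝ, EuclideanSpace ℝ (Fin 2)) ∞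
      fun p : ℝ × (sphere (0 : EuclideanSpace ℝ (Fin 2)) 1) => reflFibre s (p.2 : EuclideanSpace ℝ (Fin 2)) := by
  haveI := Fact.mk (@finrank_euclideanSpace_fin ℝ _ 2)
  exact (contDiff_reflFibre s).contMDiff.comp (contMDiff_coe_sphere.comp contMDiff_snd)

/-- `reflFibre s θ = (θ₀, s θ₁)` is a unit vector for `s² = 1`, in particular non-zero. [folklore] -/
theorem reflFibre_coe_ne_zero {s : ℝ} (hs : s ^ 2 = 1) (θ : sphere (0 : EuclideanSpace ℝ (Fin 2)) 1) :
    reflFibre s (θ : EuclideanSpace ℝ (Fin 2)) ≠ 0 := by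
  intro h0
  have h₀ := congrArg (fun v : EuclideanSpace ℝ (Fin 2) => v 0) h0
  have h₁ := congrArg (fun v : EuclideanSpace ℝ (Fin 2) => v 1) h0
  simp only [reflFibre, PiLp.add_apply, PiLp.smul_apply, smul_eq_mul, planeE0_apply_zero, planeE1_apply_zero,
    planeE0_apply_one, planeE1_apply_one, mul_one, mul_zero, add_zero, zero_add, PiLp.zero_apply, mul_eq_zero] at h₀ h₁
  have hθ := sphere_coord_sq_add_sq θ
  rcases h₁ with h₁ | h₁
  · rw [h₁] at hs; norm_num at hs
  · rw [h₀, h₁] at hθ; norm_num at hθ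

/-- The framing-direction scale `t ↦ μ^{1−t} = exp ((1 − t) log μ)` is smooth, positive, `= μ` at `t = 0`
and `= 1` at `t = 1` (`μ > 0`). [folklore] -/
theorem frameScale_props {μ : ℝ} (hμ : 0 < μ) :
    ContDiff ℝ ∞ (fun t : ℝ => Real.exp ((1 - t) * Real.log μ)) ∧ (∀ t : ℝ, 0 < Real.exp ((1 - t) * Real.log μ)) ∧
      Real.exp ((1 - (0 : ℝ)) * Real.log μ) = μ ∧ Real.exp ((1 - (1 : ℝ)) * Real.log μ) = 1 := by
  refine ⟨by fun_prop, fun t => Real.exp_pos _, ?_, ?_⟩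
  · rw [sub_zero, one_mul, Real.exp_log hμ]
  · rw [sub_self, zero_mul, Real.exp_zero]

/-! ### §3 Z5's end data in the untwisted tube, and the push-off isotopy -/

variable {W : Type} [TopologicalSpace W] [T2Space W] [ChartedSpace (EuclideanHalfSpace 4) W]
  [IsManifold (𝓡∂ 4) ∞ W]

/-- From `σ s σ_b = −1` and `s² = 1`: `σ σ_b = −s`. [folklore] -/
theorem sigma_mul_slideSign {σ s : ℝ} {b : Bool} (hs : s ^ 2 = 1) (hsgn : σ * s * slideSign b = -1) :
    σ * slideSign b = -s := by
  linear_combination s * hsgn + (-(σ * slideSign b)) * hs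

omit [T2Space W] in
/-- **Z5's end point in the untwisted coordinates**: if the second tube is `Φ₂ (ψ, v) = Φ (ψ, μ fibreRot σ ψ v)`,
then `tubeEndPoint Φ₂ b s r θ = Φ (uDir b θ, μ r e₀)` under the winding condition `σ s σ_b = −1`. [folklore] -/
theorem tubeEndPoint_of_rel (Φ Φ₂ : CircleTube ↥((𝓡∂ 4).boundary W)) {σ μ s : ℝ}
    (hΦ₂ : ∀ (ψ : sphere (0 : EuclideanSpace ℝ (Fin 2)) 1) (v : EuclideanSpace ℝ (Fin 2)),
      (((Φ₂.toHomeo (ψ, v)) : ↥((𝓡∂ 4).boundary W)) : W) =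
        tubePt Φ (ψ, μ • fibreRot σ (ψ : EuclideanSpace ℝ (Fin 2)) v))
    {b : Bool} (hs : s ^ 2 = 1) (hsgn : σ * s * slideSign b = -1) (r : ℝ) (θ : sphere (0 : EuclideanSpace ℝ (Fin 2)) 1) :
    tubeEndPoint Φ₂ b s r θ = tubePt Φ (uDir b θ, (μ * r) • planeE0) := by
  unfold tubeEndPoint
  rw [hΦ₂, fibreRot_uDir_reflFibre_smul hs (sigma_mul_slideSign hs hsgn), smul_smul]

omit [T2Space W] in
/-- **Z5's end framing in the untwisted coordinates**: the velocity of
`ε ↦ Φ (uDir b θ, μ r e₀ + ε μ reflFibre s θ)`. [folklore] -/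
theorem tubeEndFraming_of_rel (Φ Φ₂ : CircleTube ↥((𝓡∂ 4).boundary W)) {σ μ s : ℝ}
    (hΦ₂ : ∀ (ψ : sphere (0 : EuclideanSpace ℝ (Fin 2)) 1) (v : EuclideanSpace ℝ (Fin 2)),
      (((Φ₂.toHomeo (ψ, v)) : ↥((𝓡∂ 4).boundary W)) : W) =
        tubePt Φ (ψ, μ • fibreRot σ (ψ : EuclideanSpace ℝ (Fin 2)) v))
    {b : Bool} (hs : s ^ 2 = 1) (hsgn : σ * s * slideSign b = -1) (r : ℝ) (θ : sphere (0 : EuclideanSpace ℝ (Fin 2)) 1) :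
    tubeEndFraming Φ₂ b s r θ =
      mfderiv 𝓘(ℝ, ℝ) (𝓡∂ 4) (fun ε : ℝ => tubePt Φ (uDir b θ,
        (μ * r) • planeE0 + ε • (μ • reflFibre s (θ : EuclideanSpace ℝ (Fin 2))))) 0 (1 : ℝ) := by
  have hsg := sigma_mul_slideSign hs hsgn
  have e : (fun ε : ℝ => (((Φ₂.toHomeo (uDir b θ,
      reflFibre s (r • (θ : EuclideanSpace ℝ (Fin 2))) + ε • reflFibre s (sqDir θ))) : ↥((𝓡∂ 4).boundary W)) : W)) =
      fun ε : ℝ => tubePt Φ (uDir b θ, (μ * r) • planeE0 + ε • (μ • reflFibre s (θ : EuclideanSpace ℝ (Fin 2)))) := by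
    funext ε
    rw [hΦ₂, fibreRot_add, fibreRot_smul, fibreRot_uDir_reflFibre_smul hs hsg, fibreRot_uDir_reflFibre_sqDir hs hsg,
      smul_add, smul_smul, smul_comm μ ε]
  unfold tubeEndFraming
  exact congrArg (fun f : ℝ → W => mfderiv 𝓘(ℝ, ℝ) (𝓡∂ 4) f 0 (1 : ℝ)) e

/-- **The push-off isotopy (stage (3d)) in a tube `Φ` of `∂W`.**  Let the second tube be
`Φ₂ (ψ, v) = Φ (ψ, μ fibreRot σ ψ v)` (`0 < μ ≤ 1`) and assume the winding condition `σ s σ_b = −1`.  Then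
Z5's end curve `θ ↦ tubeEndPoint Φ₂ b s r θ = Φ (uDir b θ, μ r e₀)` (`0 < r < 1`) is isotopic through the knots
`θ ↦ Φ (uDir b θ, w_t)`, `w_t = (μ r cos (πt/2), −η sin (πt/2)) ≠ 0`, `‖w_t‖ < 1`, to the push-off
`θ ↦ Φ (uDir b θ, −η e₁)` (`0 < η < 1`), the isotopy carrying Z5's end framing to the fibre framings
`d/dε|₀ Φ (uDir b θ, w_t + ε μ^{1−t} reflFibre s θ)`, which end at `d/dε|₀ Φ (uDir b θ, −η e₁ + ε reflFibre s θ)`.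
[cite: Kosinski1993, VI §6] -/
theorem exists_pushoffIsotopy (Φ Φ₂ : CircleTube ↥((𝓡∂ 4).boundary W)) {σ μ s : ℝ} (hμ : 0 < μ) (hμ1 : μ ≤ 1)
    (hΦ₂ : ∀ (ψ : sphere (0 : EuclideanSpace ℝ (Fin 2)) 1) (v : EuclideanSpace ℝ (Fin 2)),
      (((Φ₂.toHomeo (ψ, v)) : ↥((𝓡∂ 4).boundary W)) : W) =
        tubePt Φ (ψ, μ • fibreRot σ (ψ : EuclideanSpace ℝ (Fin 2)) v))
    (b : Bool) (hs : s ^ 2 = 1) (hsgn : σ * s * slideSign b = -1) {r η : ℝ} (hr0 : 0 < r) (hr1 : r < 1)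
    (hη0 : 0 < η) (hη1 : η < 1) :
    ∃ (Ψ : KnotIsotopyInBoundary (fun θ => tubeEndPoint Φ₂ b s r θ) (fun θ => tubePt Φ (uDir b θ, (-η) • planeE1)))
      (νt : ℝ → sphere (0 : EuclideanSpace ℝ (Fin 2)) 1 → EuclideanSpace ℝ (Fin 4)),
      (∀ t θ, Ψ.toFun t θ = tubePt Φ (uDir b θ,
        ((μ * r) * Real.cos (π / 2 * t)) • planeE0 + (-(η * Real.sin (π / 2 * t))) • planeE1)) ∧
      IsFramingAlong Ψ (tubeEndFraming Φ₂ b s r) νt ∧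
      (∀ θ, νt 1 θ = mfderiv 𝓘(ℝ, ℝ) (𝓡∂ 4) (fun ε : ℝ => tubePt Φ (uDir b θ,
        (-η) • planeE1 + ε • reflFibre s (θ : EuclideanSpace ℝ (Fin 2)))) 0 (1 : ℝ)) := by
  obtain ⟨hsc, hpos, hsc0, hsc1⟩ := frameScale_props hμ
  have hμr0 : 0 < μ * r := mul_pos hμ hr0
  have hμr1 : μ * r < 1 := by nlinarith
  have hw := contMDiff_pushoffFibre (μ * r) η
  have hζ : ContMDiff (𝓘(ℝ, ℝ).prod (𝓡 1)) 𝓘(ℝ, EuclideanSpace ℝ (Fin 2)) ∞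
      fun p : ℝ × (sphere (0 : EuclideanSpace ℝ (Fin 2)) 1) =>
        Real.exp ((1 - p.1) * Real.log μ) • reflFibre s (p.2 : EuclideanSpace ℝ (Fin 2)) :=
    (hsc.contMDiff.comp contMDiff_fst).smul (contMDiff_reflFibre_snd s)
  have hw1 : ∀ (t : ℝ) (_ : sphere (0 : EuclideanSpace ℝ (Fin 2)) 1),
      ‖(((μ * r) * Real.cos (π / 2 * t)) • planeE0 + (-(η * Real.sin (π / 2 * t))) • planeE1 : EuclideanSpace ℝ (Fin 2))‖ < 1 :=
    fun t _ => norm_pushoffFibre_lt hμr0.le hμr1 hη0.le hη1 t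
  have hζ0 : ∀ (t : ℝ) (θ : sphere (0 : EuclideanSpace ℝ (Fin 2)) 1),
      Real.exp ((1 - t) * Real.log μ) • reflFibre s (θ : EuclideanSpace ℝ (Fin 2)) ≠ 0 :=
    fun t θ => smul_ne_zero (hpos t).ne' (reflFibre_coe_ne_zero hs θ)
  have hfr := isFramingAlong_tubeCurve Φ b (w := fun t _ =>
    (((μ * r) * Real.cos (π / 2 * t)) • planeE0 + (-(η * Real.sin (π / 2 * t))) • planeE1 : EuclideanSpace ℝ (Fin 2)))
    (ζ := fun t θ => Real.exp ((1 - t) * Real.log μ) • reflFibre s (θ : EuclideanSpace ℝ (Fin 2))) hw hζ hw1 hζ0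
  have e0 : tubeCurve Φ b (fun t _ =>
      (((μ * r) * Real.cos (π / 2 * t)) • planeE0 + (-(η * Real.sin (π / 2 * t))) • planeE1 : EuclideanSpace ℝ (Fin 2))) 0 =
      fun θ => tubeEndPoint Φ₂ b s r θ := by
    funext θ
    rw [tubeEndPoint_of_rel Φ Φ₂ hΦ₂ hs hsgn]
    show tubePt Φ (uDir b θ, ((μ * r) * Real.cos (π / 2 * (0 : ℝ))) • planeE0 +
      (-(η * Real.sin (π / 2 * (0 : ℝ)))) • planeE1) = _
    rw [pushoffFibre_zero]
  have e1 : tubeCurve Φ b (fun t _ =>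
      (((μ * r) * Real.cos (π / 2 * t)) • planeE0 + (-(η * Real.sin (π / 2 * t))) • planeE1 : EuclideanSpace ℝ (Fin 2))) 1 =
      fun θ => tubePt Φ (uDir b θ, (-η) • planeE1) := by
    funext θ
    show tubePt Φ (uDir b θ, ((μ * r) * Real.cos (π / 2 * (1 : ℝ))) • planeE0 +
      (-(η * Real.sin (π / 2 * (1 : ℝ)))) • planeE1) = _
    rw [pushoffFibre_one]
  have eν : tubeCurveFraming Φ b (fun t _ =>
      (((μ * r) * Real.cos (π / 2 * t)) • planeE0 + (-(η * Real.sin (π / 2 * t))) • planeE1 : EuclideanSpace ℝ (Fin 2)))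
      (fun t θ => Real.exp ((1 - t) * Real.log μ) • reflFibre s (θ : EuclideanSpace ℝ (Fin 2))) 0 =
      tubeEndFraming Φ₂ b s r := by
    funext θ
    rw [tubeEndFraming_of_rel Φ Φ₂ hΦ₂ hs hsgn]
    have e3 : (fun ε : ℝ => tubePt Φ (uDir b θ,
        (((μ * r) * Real.cos (π / 2 * (0 : ℝ))) • planeE0 + (-(η * Real.sin (π / 2 * (0 : ℝ)))) • planeE1) +
          ε • (Real.exp ((1 - (0 : ℝ)) * Real.log μ) • reflFibre s (θ : EuclideanSpace ℝ (Fin 2))))) =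
        fun ε : ℝ => tubePt Φ (uDir b θ, (μ * r) • planeE0 + ε • (μ • reflFibre s (θ : EuclideanSpace ℝ (Fin 2)))) := by
      funext ε
      rw [pushoffFibre_zero, hsc0]
    exact congrArg (fun f : ℝ → W => mfderiv 𝓘(ℝ, ℝ) (𝓡∂ 4) f 0 (1 : ℝ)) e3
  refine ⟨isotopyCast (tubeCurveIsotopy Φ b hw hw1) e0 e1, _, fun t θ => rfl, isFramingAlong_cast hfr e0 e1 eν,
    fun θ => ?_⟩
  have e4 : (fun ε : ℝ => tubePt Φ (uDir b θ,
      (((μ * r) * Real.cos (π / 2 * (1 : ℝ))) • planeE0 + (-(η * Real.sin (π / 2 * (1 : ℝ)))) • planeE1) +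
        ε • (Real.exp ((1 - (1 : ℝ)) * Real.log μ) • reflFibre s (θ : EuclideanSpace ℝ (Fin 2))))) =
      fun ε : ℝ => tubePt Φ (uDir b θ, (-η) • planeE1 + ε • reflFibre s (θ : EuclideanSpace ℝ (Fin 2))) := by
    funext ε
    rw [pushoffFibre_one, hsc1, one_smul]
  exact congrArg (fun f : ℝ → W => mfderiv 𝓘(ℝ, ℝ) (𝓡∂ 4) f 0 (1 : ℝ)) e4

/-! ### §4 Registered helper: stage (3d) for a tube of `∂ Base g` (the text agreed with the assembler Y1) -/

/-- **Registered helper `helper_belt_tubePushoff` (node T3c-1 of NF6 `stub_steinRealisation`, stage (3d), wave 4,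
lead c5; statement agreed with the assembler Y1).**  Let `Φ` be ANY circle tube of `∂ Base g` and `Φ₂` a second
tube with `Φ₂ (ψ, v) = Φ (ψ, μ fibreRot σ ψ v)` (`σ² = 1`, `0 < μ ≤ 1`: a fibre twist composed with a radial
shrink), `b` a slide direction and `s` (`s² = 1`) Z5's reflection sign, under the winding condition
`σ s slideSign b = −1`.  Then for every `r ∈ (0, 1)` there is a push-off depth `η' ∈ (0, 1)`, `η' ≤ η₀`, and an
isotopy of knots in `∂ Base g` from Z5's end knot `tubeEndPoint Φ₂ b s r` to the push-off
`θ ↦ Φ (uDir b θ, −η' e₁)`, all stages tube points `Φ q` with `q` in the source and OFF THE CORE (`q.2 ≠ 0`),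
carrying Z5's end framing `tubeEndFraming Φ₂ b s r` to a family ending exactly at the fibre framing
`d/dε|₀ Φ (uDir b θ, −η' e₁ + ε reflFibre s θ)`. [cite: Kosinski1993, VI §6] -/
theorem helper_belt_tubePushoff :
    ∀ (g : ℕ) (Φ : Literature.Topology.FourManifolds.CircleTube
        (Literature.Topology.FourManifolds.LefschetzBase.bBase g).carrier)
      (σ : ℝ) (_ : σ ^ 2 = 1) (μ : ℝ) (_ : 0 < μ) (_ : μ ≤ 1)
      (Φ₂ : Literature.Topology.FourManifolds.CircleTube
        ↥((𝓡∂ 4).boundary (Literature.Topology.FourManifolds.LefschetzBase.Base g)))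
      (_ : ∀ (ψ : Metric.sphere (0 : EuclideanSpace ℝ (Fin 2)) 1) (v : EuclideanSpace ℝ (Fin 2)),
        ((Φ₂.toHomeo (ψ, v) : ↥((𝓡∂ 4).boundary (Literature.Topology.FourManifolds.LefschetzBase.Base g))) :
            Literature.Topology.FourManifolds.LefschetzBase.Base g) =
          (Literature.Topology.FourManifolds.LefschetzBase.bBase g).incl
            (Φ.toHomeo (ψ, μ • Literature.Topology.FourManifolds.fibreRot σ
              (ψ : EuclideanSpace ℝ (Fin 2)) v)))
      (b : Bool) (s : ℝ) (_ : s ^ 2 = 1)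
      (_ : σ * s * Summit.SmoothPoincare4.SmoothPoincare4.Theorems.AcyclicBisectionExists.ModpBraidOrbits.slideSign b = -1)
      (η₀ : ℝ) (_ : 0 < η₀),
      ∃ r₁ : ℝ, 0 < r₁ ∧ ∀ r : ℝ, 0 < r → r < r₁ →
        ∃ η' : ℝ, 0 < η' ∧ η' < 1 ∧ η' ≤ η₀ ∧
          ∃ (Ψ : Literature.Geometry.Symplectic.KnotIsotopyInBoundary
              (fun θ => Summit.SmoothPoincare4.SmoothPoincare4.Theorems.AcyclicBisectionExists.ModpBraidOrbits.tubeEndPoint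
                Φ₂ b s r θ)
              (fun θ => (Literature.Topology.FourManifolds.LefschetzBase.bBase g).incl
                (Φ.toHomeo (Summit.SmoothPoincare4.SmoothPoincare4.Theorems.AcyclicBisectionExists.ModpBraidOrbits.uDir b θ,
                  (-η') • Literature.Topology.FourManifolds.planeE1))))
            (νt : ℝ → Metric.sphere (0 : EuclideanSpace ℝ (Fin 2)) 1 → EuclideanSpace ℝ (Fin 4)),
            (∀ t θ, ∃ q ∈ Φ.toHomeo.source, q.2 ≠ 0 ∧
              Ψ.toFun t θ = (Literature.Topology.FourManifolds.LefschetzBase.bBase g).incl (Φ.toHomeo q)) ∧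
            Literature.Geometry.Symplectic.IsFramingAlong Ψ
              (Summit.SmoothPoincare4.SmoothPoincare4.Theorems.AcyclicBisectionExists.ModpBraidOrbits.tubeEndFraming
                Φ₂ b s r) νt ∧
            ∀ θ, νt 1 θ = mfderiv 𝓘(ℝ, ℝ) (𝓡∂ 4)
              (fun ε : ℝ => (Literature.Topology.FourManifolds.LefschetzBase.bBase g).incl
                (Φ.toHomeo (Summit.SmoothPoincare4.SmoothPoincare4.Theorems.AcyclicBisectionExists.ModpBraidOrbits.uDir b θ,
                  (-η') • Literature.Topology.FourManifolds.planeE1 +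
                    ε • Summit.SmoothPoincare4.SmoothPoincare4.Theorems.AcyclicBisectionExists.ModpBraidOrbits.reflFibre
                      s (θ : EuclideanSpace ℝ (Fin 2)))))
              0 (1 : ℝ) := by
  intro g Φ σ _hσ μ hμ hμ1 Φ₂ hΦ₂ b s hs hsgn η₀ hη₀
  refine ⟨1, one_pos, fun r hr0 hr1 => ⟨min η₀ (1 / 2), lt_min hη₀ (by norm_num),
    (min_le_right _ _).trans_lt (by norm_num), min_le_left _ _, ?_⟩⟩
  obtain ⟨Ψ, νt, hΨ, hfr, hend⟩ := exists_pushoffIsotopy (W := Literature.Topology.FourManifolds.LefschetzBase.Base g)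
    Φ Φ₂ hμ hμ1 hΦ₂ b hs hsgn hr0 hr1 (η := min η₀ (1 / 2)) (lt_min hη₀ (by norm_num))
    ((min_le_right _ _).trans_lt (by norm_num))
  refine ⟨Ψ, νt, fun t θ => ⟨(uDir b θ, ((μ * r) * Real.cos (π / 2 * t)) • planeE0 +
    (-(min η₀ (1 / 2) * Real.sin (π / 2 * t))) • planeE1), Φ.mem_source_iff.2 ?_, ?_, hΨ t θ⟩, hfr, hend⟩
  · have hμr1 : μ * r < 1 := by nlinarith
    exact norm_pushoffFibre_lt (mul_pos hμ hr0).le hμr1 (lt_min hη₀ (by norm_num)).le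
      ((min_le_right _ _).trans_lt (by norm_num)) t
  · exact pushoffFibre_ne_zero (mul_pos hμ hr0) (lt_min hη₀ (by norm_num)) t

end Summit.SmoothPoincare4.SmoothPoincare4.Theorems.AcyclicBisectionExists.ModpBraidOrbits

end
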